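import Summits.HodgeConjecture.HodgeConjecture.Theorems.VHCAbelianSchemesRoadLefschetzSlackPin
import HarnessLib

/-!
# Road b02 (`VHCAbelianSchemesRoad`) — THE FULL PIN: on a pencil with rank-one invariants off the middle degree, EVERY side component of a
K-SR♭∃ datum is a scalar multiple of a power of `Θ`

research route conditional on HC_CM; not a corollary; Q11.4-sentence-2 already refuted in dim ≥ 3.

Sequel to `VHCAbelianSchemesRoadLefschetzSlackPin` (p437804/p438074: the Lefschetz correction `Z` is `c·Θᵖ`). The K-SR♭∃ conclusion also
requires, for every side degree `q ∈ I`, that `κ_q` be the restriction at `s₁` of a GLOBAL class `V_q` (fibrewise of type `(q,q)`). On the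
habitat where the road is open — Weil-type pencils, whose monodromy invariants OFF the middle degree are the powers of the polarisation (the
André axis' displayed binder «rank-one invariants off the middle degree», parts XXXIX–XL; van Geemen 1994 Thm. 6.12 for `B¹`) — this pins
the side components too. Door-generic, on the carriers, FACT-FREE; the rank-one hypothesis is DISPLAYED (read at ONE fibre `s₀`, in the form
«every global class of degree `2q` restricts into `ℂ·(Θ^q)|_{s₀}`»), never asserted.

* §1 `exists_eq_smul_forall_of_mem_span_map_at` — the flat pin for an arbitrary pair of global classes: `V|_{s₀} ∈ ℂ·G|_{s₀}` ⟹ `V|_s = c·G|_s`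
  for one `c` and every `s` (identity principle; `S(ℂ)` connected).
* §2 **`sideDegrees_pinned_of_lefAtDatum`** — in a K-SR♭∃ datum `(s₁, I, κ, V, …)`, every side degree `q ∈ I` at which the global classes restrict
  into `ℂ·(Θ^q)|_{s₀}` has `κ_q = c_q·(Θ^q)|_{s₁}` and `V_q ≡ c_q·Θ^q` on every fibre.
* §3 **`exists_fullyPinned_of_admissibleRepresentativesLefAt`** / `…_of_lefAtExceptionalRegime` — K-SR♭∃ (resp. regime 2) for ANY door, on a pencil
  with a Picard-rank-one fibre `s₀` (Hodge form) at which the global classes of every degree `2q ≠ 2p` restrict into `ℂ·(Θ^q)|_{s₀}`, delivers an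
  `𝒪`-admissible datum whose classes are `κ_p = a·W|_{s₁} + c·(Θᵖ)|_{s₁}` (`a ≠ 0`) and `κ_q = c_q·(Θ^q)|_{s₁}` for every other `q ∈ I`: the admissible
  (twisted) complex must have an `exp(θ)`-LIKE Chern character in all side degrees and exactly ONE exceptional component — the design problem of
  the BC5 habitat in its sharpest kernel form.

References: [cite: vanGeemen1994HodgeAV, §2.4, Thm. 4.11 and Thm. 6.12] [cite: DeligneHodgeII1971, Cor. 4.1.2 (proof)] [cite: VoisinHodgeII2003, Lemma 4.17]
[cite: Bloch1972Semiregularity, Remark (7.5)].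
-/

noncomputable section

open CategoryTheory CategoryTheory.Limits AlgebraicGeometry Topology

-- the cell's namespace repeats the summit name (`Summit.HodgeConjecture.HodgeConjecture…`), as in every `Ring2*` file
set_option linter.dupNamespace false

namespace Summit.HodgeConjecture.HodgeConjecture.Ring2.SemiregularRepresentatives

open Literature.AlgebraicGeometry Literature.AlgebraicGeometry.Motives
open Literature.AlgebraicGeometry.HodgeTheory
open Literature.AlgebraicTopology.SingularHomology
open Literature.Barriers.HodgeConjecture (divisorClassesSpan)
open Summit.Ventures.HSemireg (ObjClass)

variable {n : ℕ} {𝒳 S : SchemeOver ℂ} {f : 𝒳 ⟶ S}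

/-! ## §1 The flat pin for an arbitrary pair of global classes -/

/-- **Flat pin.** For global classes `V, G ∈ Hᵏ(𝒳(ℂ); ℂ)` on a smooth projective family over a smooth irreducible base: if `V|_{s₀}` lies on the
line `ℂ · G|_{s₀}` at ONE fibre, then `V|_s = c · G|_s` for one scalar `c` and EVERY fibre (`V − c·G` is a flat section vanishing at `s₀`).
[cite: DeligneHodgeII1971, Cor. 4.1.2 (proof)] [cite: VoisinHodgeII2003, Lemma 4.17] [cite: SGA1, Exp. XII Prop. 2.4] -/
theorem exists_eq_smul_forall_of_mem_span_map_at (hf : IsSmoothProjectiveFamily f n) (hirr : IrreducibleSpace S.left)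
    (hsm : AlgebraicGeometry.Smooth S.hom) {k : ℕ} (G V : complexBetti 𝒳 k) {s₀ : ComplexPoints S}
    (hV : complexBetti.map (fiberι f s₀) k V ∈ ℂ ∙ complexBetti.map (fiberι f s₀) k G) :
    ∃ c : ℂ, ∀ s : ComplexPoints S, complexBetti.map (fiberι f s) k V = c • complexBetti.map (fiberι f s) k G := by
  obtain ⟨c, hc⟩ := Submodule.mem_span_singleton.1 hV
  refine ⟨c, fun s ↦ ?_⟩
  haveI := hirr
  haveI := hsm
  haveI : ConnectedSpace (ComplexPoints S) := connectedSpace_complexPoints_of_irreducibleSpace S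
  have h0 : complexBetti.map (fiberι f s₀) k (V - c • G) = 0 := by
    rw [map_sub, map_smul, hc, sub_self]
  have h := complexBetti_map_fiberι_eq_zero_of_eq_zero_at f hf h0 s
  rwa [map_sub, map_smul, sub_eq_zero] at h

/-! ## §2 Side degrees of a K-SR♭∃ datum -/

/-- **Side components are pinned.** In the data of K-SR♭∃ (`κ_q = V_q|_{s₁}` for `q ∈ I`, `V_q` global): at every side degree `q ∈ I` for which
ALL global classes of degree `2q` restrict into the line `ℂ · (Θ^q)|_{s₀}` at one fibre `s₀` (rank-one invariants in degree `2q`, read at `s₀`),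
`V_q ≡ c_q · Θ^q` on every fibre and `κ_q = c_q · (Θ^q)|_{s₁}`. [cite: vanGeemen1994HodgeAV, Thm. 6.12] [cite: DeligneHodgeII1971, Cor. 4.1.2 (proof)] -/
theorem sideDegrees_pinned_of_lefAtDatum (hf : IsSmoothProjectiveFamily f n) (hirr : IrreducibleSpace S.left)
    (hsm : AlgebraicGeometry.Smooth S.hom) (Θ : complexBetti 𝒳 2) {s₀ s₁ : ComplexPoints S} {I : Finset ℕ}
    (κ : (q : ℕ) → complexBetti (fiberOver f s₁) (2 * q)) (V : (q : ℕ) → complexBetti 𝒳 (2 * q))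
    (hκV : ∀ q ∈ I, κ q = complexBetti.map (fiberι f s₁) (2 * q) (V q))
    {q : ℕ} (hq : q ∈ I)
    (hside : ∀ V' : complexBetti 𝒳 (2 * q),
      complexBetti.map (fiberι f s₀) (2 * q) V' ∈ ℂ ∙ complexBetti.map (fiberι f s₀) (2 * q) (cupPowTwo Θ q)) :
    ∃ c : ℂ, (∀ s : ComplexPoints S, complexBetti.map (fiberι f s) (2 * q) (V q) = c • complexBetti.map (fiberι f s) (2 * q) (cupPowTwo Θ q)) ∧
      κ q = c • complexBetti.map (fiberι f s₁) (2 * q) (cupPowTwo Θ q) := by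
  obtain ⟨c, hc⟩ := exists_eq_smul_forall_of_mem_span_map_at hf hirr hsm (cupPowTwo Θ q) (V q) (hside (V q))
  exact ⟨c, hc, by rw [hκV q hq, hc s₁]⟩

/-! ## §3 The fully pinned datum -/

/-- **K-SR♭∃ ⟹ a FULLY PINNED datum**, every door: on a pencil with a fibre `s₀` of Picard number one (Hodge form, w.r.t. `Θ|_{s₀}`) at which, in
every degree `2q` with `q ≠ p`, all global classes restrict into `ℂ · (Θ^q)|_{s₀}`, the conclusion of `AdmissibleRepresentativesLefAt 𝒪` yields a
fibre `s₁`, degrees `I ∋ p` and an `𝒪`-admissible `κ` with `κ_p = a·W|_{s₁} + c·(Θᵖ)|_{s₁}`, `a ≠ 0`, and `κ_q = c_q·(Θ^q)|_{s₁}` for every other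
`q ∈ I`. [cite: Bloch1972Semiregularity, Remark (7.5)] [cite: vanGeemen1994HodgeAV, Thm. 4.11 and Thm. 6.12] [cite: DeligneHodgeII1971, Cor. 4.1.2 (proof)] -/
theorem exists_fullyPinned_of_admissibleRepresentativesLefAt {𝒪 : ObjClass} (h : AdmissibleRepresentativesLefAt 𝒪)
    (hf : IsSmoothProjectiveFamily f n) (h𝒳 : IsQuasiProjectiveOver 𝒳) (hirr : IrreducibleSpace S.left) (haff : IsAffine S.left)
    (hsm : AlgebraicGeometry.Smooth S.hom) (hdim : topologicalKrullDim S.left = 1)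
    (habel : ∀ s : ComplexPoints S, ∃ A' : AbelianVariety ℂ, A'.dim = n ∧ Nonempty (A'.X ≅ fiberOver f s))
    (he : ∃ e : S ⟶ 𝒳, e ≫ f = 𝟙 S) (p : ℕ) (W : complexBetti 𝒳 (2 * p))
    (hW : ∀ s : ComplexPoints S, IsRationalClass (complexBetti.map (fiberι f s) (2 * p) W) ∧
      IsOfHodgeType n (fiberOver f s) (2 * p) p p (complexBetti.map (fiberι f s) (2 * p) W))
    (s' : ComplexPoints S) (hs' : complexBetti.map (fiberι f s') (2 * p) W ∈ algebraicClasses (fiberOver f s') p)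
    (Θ : complexBetti 𝒳 2) {s₀ : ComplexPoints S}
    (hpic : ∀ b : complexBetti (fiberOver f s₀) 2, IsRationalClass b → IsOfHodgeType n (fiberOver f s₀) 2 1 1 b →
      b ∈ ℂ ∙ complexBetti.map (fiberι f s₀) 2 Θ)
    (hside : ∀ q : ℕ, q ≠ p → ∀ V' : complexBetti 𝒳 (2 * q),
      complexBetti.map (fiberι f s₀) (2 * q) V' ∈ ℂ ∙ complexBetti.map (fiberι f s₀) (2 * q) (cupPowTwo Θ q)) :
    ∃ (s₁ : ComplexPoints S) (I : Finset ℕ) (κ : (q : ℕ) → complexBetti (fiberOver f s₁) (2 * q)) (a c : ℂ) (cs : ℕ → ℂ),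
      p ∈ I ∧ 𝒪 n (fiberOver f s₁) I κ ∧ a ≠ 0 ∧
      κ p = a • complexBetti.map (fiberι f s₁) (2 * p) W + c • complexBetti.map (fiberι f s₁) (2 * p) (cupPowTwo Θ p) ∧
      (∀ q ∈ I, q ≠ p → κ q = cs q • complexBetti.map (fiberι f s₁) (2 * q) (cupPowTwo Θ q)) := by
  obtain ⟨s₁, I, κ, V, a, c, hpI, hκ, ha, hκp, -, hκV, -⟩ :=
    exists_pinned_of_admissibleRepresentativesLefAt h hf h𝒳 hirr haff hsm hdim habel he p W hW s' hs' Θ hpic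
  have hq : ∀ q ∈ I, q ≠ p → ∃ cq : ℂ, κ q = cq • complexBetti.map (fiberι f s₁) (2 * q) (cupPowTwo Θ q) := fun q hqI hqp ↦ by
    obtain ⟨cq, -, hcq⟩ := sideDegrees_pinned_of_lefAtDatum hf hirr hsm Θ κ V hκV hqI (hside q hqp)
    exact ⟨cq, hcq⟩
  classical
  refine ⟨s₁, I, κ, a, c, fun q ↦ if hq' : q ∈ I ∧ q ≠ p then (hq q hq'.1 hq'.2).choose else 0, hpI, hκ, ha, hκp,
    fun q hqI hqp ↦ ?_⟩
  have hsel : (fun q ↦ if hq' : q ∈ I ∧ q ≠ p then (hq q hq'.1 hq'.2).choose else (0 : ℂ)) q = (hq q hqI hqp).choose := by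
    simp only [dif_pos (And.intro hqI hqp)]
  rw [hsel]
  exact (hq q hqI hqp).choose_spec

/-- **Regime 2 ⟹ a FULLY PINNED datum** (the same for stub 2's statement). [cite: Bloch1972Semiregularity, Remark (7.5)]
[cite: vanGeemen1994HodgeAV, Thm. 4.11 and Thm. 6.12] [cite: DeligneHodgeII1971, Cor. 4.1.2 (proof)] -/
theorem exists_fullyPinned_of_lefAtExceptionalRegime {𝒪 : ObjClass} (h : LefAtExceptionalRegime 𝒪)
    (hf : IsSmoothProjectiveFamily f n) (h𝒳 : IsQuasiProjectiveOver 𝒳) (hirr : IrreducibleSpace S.left) (haff : IsAffine S.left)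
    (hsm : AlgebraicGeometry.Smooth S.hom) (hdim : topologicalKrullDim S.left = 1)
    (habel : ∀ s : ComplexPoints S, ∃ A' : AbelianVariety ℂ, A'.dim = n ∧ Nonempty (A'.X ≅ fiberOver f s))
    (he : ∃ e : S ⟶ 𝒳, e ≫ f = 𝟙 S) (p : ℕ) (W : complexBetti 𝒳 (2 * p))
    (hW : ∀ s : ComplexPoints S, IsRationalClass (complexBetti.map (fiberι f s) (2 * p) W) ∧
      IsOfHodgeType n (fiberOver f s) (2 * p) p p (complexBetti.map (fiberι f s) (2 * p) W))
    (s' : ComplexPoints S) (hs' : complexBetti.map (fiberι f s') (2 * p) W ∈ algebraicClasses (fiberOver f s') p)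
    (hexc : ¬ ∀ s : ComplexPoints S,
      complexBetti.map (fiberι f s) (2 * p) W ∈ algebraicClasses (fiberOver f s) p ∧
      complexBetti.map (fiberι f s) (2 * p) W ∈ divisorClassesSpan (fiberOver f s) n p)
    (Θ : complexBetti 𝒳 2) {s₀ : ComplexPoints S}
    (hpic : ∀ b : complexBetti (fiberOver f s₀) 2, IsRationalClass b → IsOfHodgeType n (fiberOver f s₀) 2 1 1 b →
      b ∈ ℂ ∙ complexBetti.map (fiberι f s₀) 2 Θ)
    (hside : ∀ q : ℕ, q ≠ p → ∀ V' : complexBetti 𝒳 (2 * q),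
      complexBetti.map (fiberι f s₀) (2 * q) V' ∈ ℂ ∙ complexBetti.map (fiberι f s₀) (2 * q) (cupPowTwo Θ q)) :
    ∃ (s₁ : ComplexPoints S) (I : Finset ℕ) (κ : (q : ℕ) → complexBetti (fiberOver f s₁) (2 * q)) (a c : ℂ) (cs : ℕ → ℂ),
      p ∈ I ∧ 𝒪 n (fiberOver f s₁) I κ ∧ a ≠ 0 ∧
      κ p = a • complexBetti.map (fiberι f s₁) (2 * p) W + c • complexBetti.map (fiberι f s₁) (2 * p) (cupPowTwo Θ p) ∧
      (∀ q ∈ I, q ≠ p → κ q = cs q • complexBetti.map (fiberι f s₁) (2 * q) (cupPowTwo Θ q)) := by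
  obtain ⟨s₁, I, κ, V, a, c, hpI, hκ, ha, hκp, -, hκV, -⟩ :=
    exists_pinned_of_lefAtExceptionalRegime h hf h𝒳 hirr haff hsm hdim habel he p W hW s' hs' hexc Θ hpic
  have hq : ∀ q ∈ I, q ≠ p → ∃ cq : ℂ, κ q = cq • complexBetti.map (fiberι f s₁) (2 * q) (cupPowTwo Θ q) := fun q hqI hqp ↦ by
    obtain ⟨cq, -, hcq⟩ := sideDegrees_pinned_of_lefAtDatum hf hirr hsm Θ κ V hκV hqI (hside q hqp)
    exact ⟨cq, hcq⟩
  classical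
  refine ⟨s₁, I, κ, a, c, fun q ↦ if hq' : q ∈ I ∧ q ≠ p then (hq q hq'.1 hq'.2).choose else 0, hpI, hκ, ha, hκp,
    fun q hqI hqp ↦ ?_⟩
  have hsel : (fun q ↦ if hq' : q ∈ I ∧ q ≠ p then (hq q hq'.1 hq'.2).choose else (0 : ℂ)) q = (hq q hqI hqp).choose := by
    simp only [dif_pos (And.intro hqI hqp)]
  rw [hsel]
  exact (hq q hqI hqp).choose_spec

end Summit.HodgeConjecture.HodgeConjecture.Ring2.SemiregularRepresentatives

end
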